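import Summits.BirchSwinnertonDyer.BirchSwinnertonDyer.Theorems.ThetaPartnerAtTwoSignedControlAtTwoMuRealShaDualAnnihilator
import Summits.BirchSwinnertonDyer.BirchSwinnertonDyer.Theorems.SchneiderFreeAdditiveX3PoitouTateUnramifiedOrthogonalAllLevels
import Summits.BirchSwinnertonDyer.Rank1Residual.GaloisImage.SelmerGroupFinite
import HarnessLib

/-!
# Poitou–Tate at fields WITH REAL PLACES for THE invariant maps: `Ш¹` finite, the annihilator of `Ш¹(K, M^D)` and the
# `(n, M)`-clause of `poitouTate_sha_tateDual K` from `hE(n)` (Milne I 4.10 (b), canonical family) and a degree-2 readout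

Crux K4 `SignedControlAtTwo` (stmt-BirchSwinnertonDyer-20309; routes `ThetaPartnerAtTwo` / `ResidualThetaTransportAtTwo`), line
`eulerchar` v12, lead `bsd-wall-tp2-p3` g4 (`--supports stmt-BirchSwinnertonDyer-20309`, helper).  Sequel of
`…MuRealShaDualAnnihilator.lean` (the annihilator / perfect pairing for ANY family perfect at the finite places and injective
at the real places).  Here the family is THE one of the tree, `LocalInvariants.canonical K n` (local residue maps +
archimedean invariants), for which `IsPerfect` (`canonical_isPerfect`), `InjectiveAtRealPlaces`
(`canonical_injectiveAtRealPlaces`), Milne I Thm. 2.6 at all levels (`unramifiedOrthogonal_of_isPerfect_allLevels`) are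
THEOREMS and `SelmerComplement` at level `n` is REDUCED to Milne I 4.10 (b) `hE(n)` for that family
(`selmerComplement_canonical_of_middleExact_allLevels`, cell bsd-schneider's road (A)) — all valid at fields with real
places.  So, for ANY number field `K` (`K = ℚ`, `n = 2^k`, `M = E[2^k]` being crux K4's `stub_poitouTateShaRat`):

* `finite_sha_of_isUnramifiedAt`, `finite_sha_tateDual_of_isUnramifiedAt` — `Ш¹(K, M)` and `Ш¹(K, M^D)` are finite for a
  finite module unramified outside a finite set (inside the everywhere-unramified Selmer group; Hermite–Minkowski via the
  tree's `SelmerFinite.finite_selmerGroup_of_unramified_outside`);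
* `sha_annihilator_canonical_of_middleExact_real` — `hE(n)` alone ⟹ every additive `φ : H¹(K, M^D) → ℤ/n` vanishing on
  `Ш¹(K, M^D)` is `y ↦ ∑_v inv_v(t_v ∪ y_v)` for ONE `t ∈ ∏_v H¹(K_v, M)`, archimedean components live (the real-place
  version of `PoitouTateShaAnnihilator.sha_annihilator_canonical_of_middleExact`, seat bsd-line-chl-p2 g5);
* **`sha_tateDual_clause_canonical_of_middleExact_of_readout`** — `hE(n)` + a readout `e : Ш²(K, M) → Hom(H¹(K, M^D), ℤ/n)`
  additive / injective / surjective modulo canonical local sums ⟹ `Finite Ш¹(K, M^D) ∧ Finite Ш²(K, M) ∧ ∃ b, Bijective b ∧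
  Bijective b.flip` — VERBATIM the `(n, M, ρ)`-clause of `poitouTate_sha_tateDual K`.  NET for K4: the registered stub
  `poitouTate_sha_tateDual ℚ` ⟸ road (A)'s two deliverables {`hE(n)` for the canonical family over `ℚ`, the degree-2
  readout over `ℚ`}, exactly as at totally complex fields; nothing archimedean is left over.

HONEST FRAMING. THEOREMS ONLY (no definition, no named fact, no `sorry`); `hE(n)` and the readout are displayed hypotheses,
NOT discharged; closes no item; BSD is not proved by any of this.  `K : Type` (universe `0`) in §2, as in the
`PoitouTateReduction` files.  References: [MilneADT2006] I Thm. 4.10 (a)(b), Lemma 4.8, Cor. 2.3, Thm. 2.6, Thm. 2.13 (a),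
Ex. 1.6 (c); [Harari2020] Thm. 17.13 (b); [Howard2004HeegnerKolyvagin] Thm. 2.1.11.
-/

noncomputable section

set_option linter.dupNamespace false
set_option autoImplicit false

namespace Summit.BirchSwinnertonDyer.BirchSwinnertonDyer.Theorems.SignedEC.MuReal

open Function NumberField IsDedekindDomain
open scoped NumberField
open Literature.NumberTheory.GaloisRepresentations
open Literature.NumberTheory.GaloisRepresentations.DiscreteGaloisModule (mu localTatePairingZMod tateDual
  unramifiedSubgroup sha shaTwo SelmerStructure)
open Literature.NumberTheory.GaloisCohomology
open Summit.BirchSwinnertonDyer.BirchSwinnertonDyer.Theorems.SchneiderFreeAdditiveX3.PoitouTateReduction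
  (isUnramifiedAt_tateDual unramifiedOrthogonal_of_isPerfect_allLevels selmerComplement_canonical_of_middleExact_allLevels)
open Summit.BirchSwinnertonDyer.Rank1Residual.GaloisImage.SelmerFinite (finite_selmerGroup_of_unramified_outside)

/-! ## §1 `Ш¹` of a finite module is finite -/

section ShaFinite

universe v

variable {K : Type v} [Field K] [NumberField K] {M : Type v} [AddCommGroup M] [TopologicalSpace M]
  [DiscreteTopology M] [Finite M]

/-- **`Ш¹(K, M)` is finite** for a finite discrete `Γ_K`-module unramified outside a finite set of places: it lies
in the Selmer group of the everywhere-unramified Selmer structure, which is finite (Hermite–Minkowski; tree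
`SelmerFinite.finite_selmerGroup_of_unramified_outside`). [cite: MilneADT2006, Ch. I, Thm. 4.10 (a) and Lemma 4.8] -/
theorem finite_sha_of_isUnramifiedAt (ρ : DiscreteGaloisModule K M) (S₀ : Finset (Place K))
    (hS₀ : ∀ v : HeightOneSpectrum (𝓞 K), (Sum.inr v : Place K) ∉ S₀ → GaloisRep.IsUnramifiedAt v ρ) :
    Finite (sha ρ) := by
  classical
  let 𝓕 : SelmerStructure ρ := SelmerStructure.ofFinite ρ fun v => unramifiedSubgroup (GaloisRep.toLocal v ρ) 1
  haveI : Finite 𝓕.selmerGroup :=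
    finite_selmerGroup_of_unramified_outside ρ (S := {v | (Sum.inr v : Place K) ∈ S₀})
      ((S₀.finite_toSet.preimage Sum.inr_injective.injOn).subset fun v hv => hv) (fun v hv => hS₀ v hv)
      (𝓕 := 𝓕) fun v _ => rfl
  exact Finite.of_injective (AddSubgroup.inclusion (DiscreteGaloisModule.sha_le_selmerGroup ρ 𝓕))
    (AddSubgroup.inclusion_injective _)

/-- **`Ш¹(K, M^D)` is finite** for `M` finite `n`-torsion unramified outside the finite `S₀ ⊇ {v ∣ n}` (`M^D` is
unramified where `M` is, away from `n`). [cite: MilneADT2006, Ch. I, Thm. 4.10 (a)] -/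
theorem finite_sha_tateDual_of_isUnramifiedAt (ρ : DiscreteGaloisModule K M) (n : ℕ) [NeZero n]
    (S₀ : Finset (Place K))
    (hS₀ : ∀ v : HeightOneSpectrum (𝓞 K), (Sum.inr v : Place K) ∉ S₀ →
      ((n : ℕ) : 𝓞 K) ∉ v.asIdeal ∧ GaloisRep.IsUnramifiedAt v ρ) :
    Finite (sha (ρ.tateDual n)) :=
  haveI : Finite (DiscreteGaloisModule.TateDual K M n) := DiscreteGaloisModule.TateDual.finite K M n
  finite_sha_of_isUnramifiedAt (ρ.tateDual n) S₀ fun v hv => isUnramifiedAt_tateDual ρ v (hS₀ v hv).1 (hS₀ v hv).2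

end ShaFinite

/-! ## §2 THE invariant maps: the annihilator and the perfect pairing from `hE(n)` and a readout, any `K` -/

section Canonical

variable {K : Type} [Field K] [NumberField K]

/-- **The annihilator of `Ш¹(K, M^D)` for THE invariant maps (`LocalInvariants.canonical K n`), from `Ker γ¹ ⊆ Im β¹`
at level `n` — ANY number field** (real-place version of `PoitouTateShaAnnihilator.sha_annihilator_canonical_of_middleExact`):
assume Milne I 4.10 (b) for the canonical family at level `n` (hypothesis `hE`, verbatim the shape of
`selmerComplement_canonical_of_middleExact_allLevels`); then for every finite discrete `n`-torsion `M` unramified off the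
finite `S₀ ⊇ {v ∣ ∞} ∪ {v ∣ n}` and every additive `φ : H¹(K, M^D) → ℤ/n` vanishing on `Ш¹(K, M^D)` there are a finite
`S₁ ⊇ S₀` and `t ∈ ∏_v H¹(K_v, M)` (archimedean components live), unramified off `S₁`, with
`φ(y) = ∑_{v ∈ S} inv_v(t_v ∪ loc_v y)` for all `y` and all finite `S ⊇ S₁` off which `y` is unramified
(`canonical_isPerfect`, `canonical_injectiveAtRealPlaces`, `unramifiedOrthogonal_of_isPerfect_allLevels`,
`selmerComplement_canonical_of_middleExact_allLevels`, `exists_family_sum_localTatePairing_eq_real`).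
[cite: MilneADT2006, Ch. I, Thm. 4.10 (a)(b), Cor. 2.3, Thm. 2.6, Thm. 2.13 (a), Ex. 1.6 (c)]
[cite: Howard2004HeegnerKolyvagin, Thm. 2.1.11 (arXiv:1202.6340 p. 6)] -/
theorem sha_annihilator_canonical_of_middleExact_real (n : ℕ) [NeZero n]
    (hE : ∀ ⦃M : Type⦄ [AddCommGroup M] [TopologicalSpace M] [DiscreteTopology M] [Finite M]
      (ρ : DiscreteGaloisModule K M), (∀ m : M, n • m = 0) →
      ∀ S : Finset (Place K), (∀ w : InfinitePlace K, (Sum.inl w : Place K) ∈ S) →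
        (∀ v : HeightOneSpectrum (𝓞 K), (Sum.inr v : Place K) ∉ S →
          ((n : ℕ) : 𝓞 K) ∉ v.asIdeal ∧ GaloisRep.IsUnramifiedAt v ρ) →
        ∀ t : Π v : Place K, galoisCohomology (ρ.toLocal v) 1,
          (∀ y : galoisCohomology (ρ.tateDual n) 1,
            (∀ v : HeightOneSpectrum (𝓞 K), (Sum.inr v : Place K) ∉ S →
              galoisCohomology.localization (ρ.tateDual n) (Sum.inr v) 1 y ∈
                unramifiedSubgroup (GaloisRep.toLocal v (ρ.tateDual n)) 1) →
            ∑ v ∈ S, localTatePairingZMod ρ n v (LocalInvariants.canonical K n v) (t v)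
              (galoisCohomology.localization (ρ.tateDual n) v 1 y) = 0) →
          ∃ x : galoisCohomology ρ 1,
            (∀ v : HeightOneSpectrum (𝓞 K), (Sum.inr v : Place K) ∉ S →
              galoisCohomology.localization ρ (Sum.inr v) 1 x ∈
                unramifiedSubgroup (GaloisRep.toLocal v ρ) 1) ∧
            ∀ v ∈ S, galoisCohomology.localization ρ v 1 x = t v)
    {M : Type} [AddCommGroup M] [TopologicalSpace M] [DiscreteTopology M] [Finite M]
    (ρ : DiscreteGaloisModule K M) (hM : ∀ m : M, n • m = 0)
    (S₀ : Finset (Place K)) (hinf : ∀ w : InfinitePlace K, (Sum.inl w : Place K) ∈ S₀)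
    (hS₀ : ∀ v : HeightOneSpectrum (𝓞 K), (Sum.inr v : Place K) ∉ S₀ →
      ((n : ℕ) : 𝓞 K) ∉ v.asIdeal ∧ GaloisRep.IsUnramifiedAt v ρ)
    (φ : galoisCohomology (ρ.tateDual n) 1 →+ ZMod n)
    (hφ : ∀ y ∈ sha (ρ.tateDual n), φ y = 0) :
    ∃ (S₁ : Finset (Place K)) (t : Π v : Place K, galoisCohomology (ρ.toLocal v) 1),
      S₀ ⊆ S₁ ∧
      (∀ v : HeightOneSpectrum (𝓞 K), (Sum.inr v : Place K) ∉ S₁ →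
        t (Sum.inr v) ∈ unramifiedSubgroup (GaloisRep.toLocal v ρ) 1) ∧
      ∀ (y : galoisCohomology (ρ.tateDual n) 1) (S : Finset (Place K)), S₁ ⊆ S →
        (∀ v : HeightOneSpectrum (𝓞 K), (Sum.inr v : Place K) ∉ S →
          galoisCohomology.localization (ρ.tateDual n) (Sum.inr v) 1 y ∈
            unramifiedSubgroup (GaloisRep.toLocal v (ρ.tateDual n)) 1) →
        φ y = ∑ v ∈ S, localTatePairingZMod ρ n v (LocalInvariants.canonical K n v) (t v)
          (galoisCohomology.localization (ρ.tateDual n) v 1 y) :=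
  exists_family_sum_localTatePairing_eq_real LocalInvariants.canonical_isPerfect
    LocalInvariants.canonical_injectiveAtRealPlaces
    (unramifiedOrthogonal_of_isPerfect_allLevels _ LocalInvariants.canonical_isPerfect)
    (selmerComplement_canonical_of_middleExact_allLevels n hE) ρ hM S₀ hinf hS₀ φ hφ

/-- **The `(n, M)`-clause of `poitouTate_sha_tateDual K` for THE invariant maps, from `hE(n)` and a degree-`2` readout —
ANY number field** (`K = ℚ`, `n = 2^k`, `M = E[2^k]` is what crux K4's `stub_poitouTateShaRat` consumes).  Hypotheses:
Milne I 4.10 (b) for the canonical family at level `n` (`hE`); `M` finite `n`-torsion unramified off the finite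
`S₀ ⊇ {v ∣ ∞} ∪ {v ∣ n}`; a readout `e : Ш²(K, M) → Hom(H¹(K, M^D), ℤ/n)` additive, injective and surjective modulo sums of
canonical local pairings (archimedean components live) — the three outputs of the idèle-class road's
`Ш²(K, M) ≅ coker γ¹`.  CONCLUSION: `Ш¹(K, M^D)` and `Ш²(K, M)` are finite and there is a bi-additive
`b : Ш²(K, M) × Ш¹(K, M^D) → ℤ/n` with both adjoints bijective — verbatim the existential conclusion of the named fact
at `(n, M, ρ)`. [cite: MilneADT2006, Ch. I, Thm. 4.10 (a)(b) and proof, Thm. 2.13 (a), Ex. 1.6 (c)] [cite: Harari2020, Thm. 17.13 (b)] -/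
theorem sha_tateDual_clause_canonical_of_middleExact_of_readout (n : ℕ) [NeZero n]
    (hE : ∀ ⦃M : Type⦄ [AddCommGroup M] [TopologicalSpace M] [DiscreteTopology M] [Finite M]
      (ρ : DiscreteGaloisModule K M), (∀ m : M, n • m = 0) →
      ∀ S : Finset (Place K), (∀ w : InfinitePlace K, (Sum.inl w : Place K) ∈ S) →
        (∀ v : HeightOneSpectrum (𝓞 K), (Sum.inr v : Place K) ∉ S →
          ((n : ℕ) : 𝓞 K) ∉ v.asIdeal ∧ GaloisRep.IsUnramifiedAt v ρ) →
        ∀ t : Π v : Place K, galoisCohomology (ρ.toLocal v) 1,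
          (∀ y : galoisCohomology (ρ.tateDual n) 1,
            (∀ v : HeightOneSpectrum (𝓞 K), (Sum.inr v : Place K) ∉ S →
              galoisCohomology.localization (ρ.tateDual n) (Sum.inr v) 1 y ∈
                unramifiedSubgroup (GaloisRep.toLocal v (ρ.tateDual n)) 1) →
            ∑ v ∈ S, localTatePairingZMod ρ n v (LocalInvariants.canonical K n v) (t v)
              (galoisCohomology.localization (ρ.tateDual n) v 1 y) = 0) →
          ∃ x : galoisCohomology ρ 1,
            (∀ v : HeightOneSpectrum (𝓞 K), (Sum.inr v : Place K) ∉ S →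
              galoisCohomology.localization ρ (Sum.inr v) 1 x ∈
                unramifiedSubgroup (GaloisRep.toLocal v ρ) 1) ∧
            ∀ v ∈ S, galoisCohomology.localization ρ v 1 x = t v)
    {M : Type} [AddCommGroup M] [TopologicalSpace M] [DiscreteTopology M] [Finite M]
    (ρ : DiscreteGaloisModule K M) (hM : ∀ m : M, n • m = 0)
    (S₀ : Finset (Place K)) (hinf : ∀ w : InfinitePlace K, (Sum.inl w : Place K) ∈ S₀)
    (hS₀ : ∀ v : HeightOneSpectrum (𝓞 K), (Sum.inr v : Place K) ∉ S₀ →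
      ((n : ℕ) : 𝓞 K) ∉ v.asIdeal ∧ GaloisRep.IsUnramifiedAt v ρ)
    (e : shaTwo ρ → (galoisCohomology (ρ.tateDual n) 1 →+ ZMod n))
    (hadd : ∀ c c' : shaTwo ρ, ∃ (S₁ : Finset (Place K)) (t : Π v : Place K, galoisCohomology (ρ.toLocal v) 1),
      ∀ (y : galoisCohomology (ρ.tateDual n) 1) (S : Finset (Place K)), S₁ ⊆ S →
        (∀ v : HeightOneSpectrum (𝓞 K), (Sum.inr v : Place K) ∉ S →
          galoisCohomology.localization (ρ.tateDual n) (Sum.inr v) 1 y ∈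
            unramifiedSubgroup (GaloisRep.toLocal v (ρ.tateDual n)) 1) →
        (e (c + c') - e c - e c') y = ∑ v ∈ S, localTatePairingZMod ρ n v (LocalInvariants.canonical K n v) (t v)
          (galoisCohomology.localization (ρ.tateDual n) v 1 y))
    (hinj : ∀ c : shaTwo ρ, (∃ (S₁ : Finset (Place K)) (t : Π v : Place K, galoisCohomology (ρ.toLocal v) 1),
      S₀ ⊆ S₁ ∧
      (∀ v : HeightOneSpectrum (𝓞 K), (Sum.inr v : Place K) ∉ S₁ →
        t (Sum.inr v) ∈ unramifiedSubgroup (GaloisRep.toLocal v ρ) 1) ∧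
      ∀ (y : galoisCohomology (ρ.tateDual n) 1) (S : Finset (Place K)), S₁ ⊆ S →
        (∀ v : HeightOneSpectrum (𝓞 K), (Sum.inr v : Place K) ∉ S →
          galoisCohomology.localization (ρ.tateDual n) (Sum.inr v) 1 y ∈
            unramifiedSubgroup (GaloisRep.toLocal v (ρ.tateDual n)) 1) →
        e c y = ∑ v ∈ S, localTatePairingZMod ρ n v (LocalInvariants.canonical K n v) (t v)
          (galoisCohomology.localization (ρ.tateDual n) v 1 y)) → c = 0)
    (hsurj : ∀ φ : galoisCohomology (ρ.tateDual n) 1 →+ ZMod n, ∃ (c : shaTwo ρ) (S₁ : Finset (Place K))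
      (t : Π v : Place K, galoisCohomology (ρ.toLocal v) 1),
      ∀ (y : galoisCohomology (ρ.tateDual n) 1) (S : Finset (Place K)), S₁ ⊆ S →
        (∀ v : HeightOneSpectrum (𝓞 K), (Sum.inr v : Place K) ∉ S →
          galoisCohomology.localization (ρ.tateDual n) (Sum.inr v) 1 y ∈
            unramifiedSubgroup (GaloisRep.toLocal v (ρ.tateDual n)) 1) →
        (φ - e c) y = ∑ v ∈ S, localTatePairingZMod ρ n v (LocalInvariants.canonical K n v) (t v)
          (galoisCohomology.localization (ρ.tateDual n) v 1 y)) :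
    Finite (sha (ρ.tateDual n)) ∧ Finite (shaTwo ρ) ∧
      ∃ b : shaTwo ρ →+ sha (ρ.tateDual n) →+ ZMod n, Bijective b ∧ Bijective b.flip := by
  haveI : Finite (sha (ρ.tateDual n)) := finite_sha_tateDual_of_isUnramifiedAt ρ n S₀ hS₀
  obtain ⟨hfin, b, -, hb, hbflip⟩ :=
    sha_tateDual_of_readout_real LocalInvariants.canonical_isPerfect LocalInvariants.canonical_injectiveAtRealPlaces
      (unramifiedOrthogonal_of_isPerfect_allLevels _ LocalInvariants.canonical_isPerfect)
      (selmerComplement_canonical_of_middleExact_allLevels n hE) ρ hM S₀ hinf hS₀ e hadd hinj hsurj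
  exact ⟨inferInstance, hfin, b, hb, hbflip⟩

end Canonical

end Summit.BirchSwinnertonDyer.BirchSwinnertonDyer.Theorems.SignedEC.MuReal

end
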